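import Summits.Schanuel.Schanuel.Theorems.RootDecomp1KB3LogBarrier02

/-!
# RootDecomp1KB3LogBarrier — lens 6, generation 25 «THE RESIDUAL IS THE LOG BARRIER: B₃ = PolyDiophantineSchanuel (stmt-Schanuel-31987) ⊢ Literature.Barriers.Schanuel.AlgIndepLogarithms» (CLAIM L2309, PRICE + CHECKLIST G29-α L2310 (strength certificate), NODE L2324; critic VERDICT pending at staging — filed only on GO) — continuation (RootDecomp1KB3LogBarrier03): §3–§7 the certificate and corollaries

(lens-6 g25 HOME kernel K = HOME/decomp-schanuel-lens-6/g25/B3LogBarrier.lean e91b3d3e…, 663 l, imports Theses.RootDecomp1K + Literature BakerLinearFormsQuantitativeProofs + Barriers AlgebraicIndependenceOfLogarithmsProofs + NesterenkoModularScope; P/C + NODE-g25.md. STRENGTH CERTIFICATE, rung 0, no ∀-item moves: the route's declared RESIDUAL B₃ = `PolyDiophantineSchanuel` implies the logarithm barrier's conjecture `AlgIndepLogarithms` (Baker 1975 Thm 3.1 `baker1975_thm_3_1_holds` BY NAME, load-bearing). Port by census-1 gen 19 as `RootDecomp1KB3LogBarrier01–03`: 01 = §0 integer witnesses (`hgt`,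 `wit_int`, `wit_rat`) + §1 Baker's Thm 3.1 as a polynomial linear-independence measure for logarithms (`polyMeasure_of_logs`, `polyDioph_of_logs`); 02 = §2 no Liouville coordinates in the ℚ-span of logarithms of algebraic numbers (`wit_twist`, `not_liouville_of_logForm`, `not_liouville_coord_of_logs`, …); 03 = §3 `b3_hypotheses_of_logs`, `algIndepLogarithms_of_polyDiophantineSchanuel`, §4 corollaries by name (`schanuel_at_logs_…`, `algebraicIndependent_piI_log_two_…`, `transcendental_exp_pi_sq_…`, `threeLogarithmsConjecture_…`), §5 B₃ at z = (1, πi) (`two_le_trdeg_one_piI_…`, `expOnePiAlgebraicIndependent_of_polyDiophantineSchanuel`), §6 placement (`not_hyperLiouville_of_polyMeasure`, `logs_placement`, `cells_vacuous_at_logs`), §7 `algIndepLogarithms_of_strictDiophantineSchanuel`.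
PORT EDITS: linter option dropped; twelve generic helpers private (isAlgebraic_conj/norm/cexp_re/cexp_im, not_liouville_pi, not_liouville_rat_mul_pi, two_le_one_add_sum, cast_one_add_sum, one_div_pow_ceil_le, pow_le_exp_pow_succ, abs_coeff_le_hgt, linForm_ne_zero_of_linearIndependent — dedup-safety) with per-part private copies; two docstrings added; statements and proofs verbatim. `--supports stmt-Schanuel-31987` (the residual item) unless the verdict names another; no census credit carried; rung 0 — nothing here proves Schanuel; B₃ stays OPEN.)
-/

noncomputable section

open Complex Polynomial IntermediateField Finset
open scoped BigOperators

namespace Summit.Schanuel.Schanuel.Theorems.RootDecomp1KB3LogBarrier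

open Literature.NumberTheory.Transcendental (baker1975_thm_3_1 baker1975_thm_3_1_holds)
open Literature.Barriers.Schanuel (AlgIndepLogarithms algebraicIndependent_of_le_trdeg_adjoin
  trdeg_adjoin_union_eq_of_isAlgebraic linearIndependent_one_piI isAlgebraic_I algebraicIndependent_real_of_complex)
open Summit.Schanuel.Schanuel.Theses.RootDecomp1K (PolyDiophantineSchanuel CoordLiouvilleSchanuel
  HyperLiouvilleSchanuel FiniteOrderLiouvilleSchanuel LinLiouvilleSchanuel StrictDiophantineSchanuel)

/-- … and neither is any non-zero rational multiple `q·π` (the imaginary parts of the span of `(1, πi)`). -/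
private theorem not_liouville_rat_mul_pi (q : ℚ) : ¬ Liouville ((q : ℝ) * Real.pi) :=
  not_liouville_of_logForm_I ![(Real.pi : ℂ) * I]
    (fun i => by
      fin_cases i
      simp only [Matrix.cons_val_fin_one, Complex.exp_pi_mul_I]
      exact isAlgebraic_one.neg)
    ![q] ((q : ℝ) * Real.pi) (by simp only [Fin.sum_univ_one, Matrix.cons_val_fin_one]; push_cast; ring)

/-! ### §3  The residual implies the logarithm barrier's conjecture -/

/-- **Placement, positive side: every `ℚ`-free tuple of logarithms of algebraic numbers satisfies
the two Diophantine hypotheses of `PolyDiophantineSchanuel` (B₃).** -/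
theorem b3_hypotheses_of_logs {n : ℕ} (l : Fin n → ℂ) (halg : ∀ i, IsAlgebraic ℚ (cexp (l i)))
    (hli : LinearIndependent ℚ l) :
    (¬ ∃ w ∈ Submodule.span ℚ (Set.range l), Liouville w.re ∨ Liouville w.im) ∧
    (¬ ∀ ω : ℕ, ∃ h : Fin n → ℤ, h ≠ 0 ∧ ‖∑ i, (h i : ℂ) * l i‖ < 1 / (1 + ∑ i, (|h i| : ℝ)) ^ ω) := by
  refine ⟨not_liouville_coord_of_logs l halg, ?_⟩
  obtain ⟨ω, hω⟩ := polyMeasure_of_logs l halg hli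
  push Not
  exact ⟨ω, fun h hh => hω h hh⟩

/-- **THE AUDIT THEOREM.** The route's residual `B₃ = PolyDiophantineSchanuel` (stmt-Schanuel-31987)
implies Conjecture 1.1 of the logarithm barrier, `Literature.Barriers.Schanuel.AlgIndepLogarithms`:
`ℚ`-linearly independent logarithms of algebraic numbers are algebraically independent. Baker's
Theorem 3.1 (`baker1975_thm_3_1_holds`) is load-bearing: it certifies that such tuples lie in B₃'s
scope. -/
theorem algIndepLogarithms_of_polyDiophantineSchanuel (hB : PolyDiophantineSchanuel) :
    AlgIndepLogarithms := by
  intro n l halg hli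
  obtain ⟨h2, h3⟩ := b3_hypotheses_of_logs l halg hli
  have hT : ∀ x ∈ Set.range (cexp ∘ l), IsAlgebraic ℚ x := by
    rintro _ ⟨i, rfl⟩; exact halg i
  exact algebraicIndependent_of_le_trdeg_adjoin l
    ((hB n l hli h2 h3).trans_eq (trdeg_adjoin_union_eq_of_isAlgebraic _ _ hT))

/-- B₃ restricted to logarithms of algebraic numbers IS Schanuel there (the conclusion with the
exponentials adjoined). -/
theorem schanuel_at_logs_of_polyDiophantineSchanuel (hB : PolyDiophantineSchanuel) {n : ℕ}
    (l : Fin n → ℂ) (halg : ∀ i, IsAlgebraic ℚ (cexp (l i))) (hli : LinearIndependent ℚ l) :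
    (n : Cardinal) ≤ Algebra.trdeg ℚ ↥(adjoin ℚ (Set.range l ∪ Set.range (cexp ∘ l))) :=
  hB n l hli (b3_hypotheses_of_logs l halg hli).1 (b3_hypotheses_of_logs l halg hli).2

/-! ### §4  Corollaries by name (tree consequences of `AlgIndepLogarithms`) -/

/-- B₃ ⟹ `iπ` and `log 2` are algebraically independent. -/
theorem algebraicIndependent_piI_log_two_of_polyDiophantineSchanuel (hB : PolyDiophantineSchanuel) :
    AlgebraicIndependent ℚ ![(Real.pi : ℂ) * I, (Real.log 2 : ℂ)] :=
  Literature.Barriers.Schanuel.algebraicIndependent_piI_log_two_of_algIndepLogarithms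
    (algIndepLogarithms_of_polyDiophantineSchanuel hB)

/-- B₃ ⟹ `e^{π²}` is transcendental. -/
theorem transcendental_exp_pi_sq_of_polyDiophantineSchanuel (hB : PolyDiophantineSchanuel) :
    Transcendental ℚ (Real.exp (Real.pi ^ 2)) :=
  Literature.Barriers.Schanuel.transcendental_exp_pi_sq_of_algIndepLogarithms
    (algIndepLogarithms_of_polyDiophantineSchanuel hB)

/-- B₃ ⟹ the three-logarithms conjecture. -/
theorem threeLogarithmsConjecture_of_polyDiophantineSchanuel (hB : PolyDiophantineSchanuel) :
    Literature.Barriers.Schanuel.ThreeLogarithmsConjecture :=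
  Literature.Barriers.Schanuel.threeLogarithmsConjecture_of_algIndepLogarithms
    (algIndepLogarithms_of_polyDiophantineSchanuel hB)

/-! ### §5  B₃ at `z = (1, πi)`: Schanuel's inequality there (`e ⟂ π`) -/

/-- The `ℚ`-span of `(1, πi)` has no Liouville coordinates: real parts are rational, imaginary parts
are rational multiples of `π` (Baker at `α = −1`). -/
theorem not_liouville_coord_one_piI :
    ¬ ∃ w ∈ Submodule.span ℚ (Set.range ![(1 : ℂ), (Real.pi : ℂ) * I]), Liouville w.re ∨ Liouville w.im := by
  rintro ⟨w, hw, hLw⟩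
  obtain ⟨c, rfl⟩ := (Submodule.mem_span_range_iff_exists_fun ℚ).mp hw
  simp only [Fin.sum_univ_two, Matrix.cons_val_zero, Matrix.cons_val_one, Rat.smul_def] at hLw
  rcases hLw with hre | him
  · have hq : (((c 0 : ℂ) * 1 + (c 1 : ℂ) * ((Real.pi : ℂ) * I)).re : ℝ) = (c 0 : ℝ) := by
      simp [Complex.mul_re]
    rw [hq] at hre
    exact (Rat.not_irrational (c 0)) hre.irrational
  · have hq : (((c 0 : ℂ) * 1 + (c 1 : ℂ) * ((Real.pi : ℂ) * I)).im : ℝ) = (c 1 : ℝ) * Real.pi := by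
      simp [Complex.mul_im]
    rw [hq] at him
    exact not_liouville_rat_mul_pi (c 1) him

/-- `(1, πi)` has the trivial polynomial measure `|h₀ + h₁πi| ≥ 1 ≥ (1+|h₀|+|h₁|)^{-0}`. -/
theorem polyMeasure_one_piI :
    ¬ ∀ ω : ℕ, ∃ h : Fin 2 → ℤ, h ≠ 0 ∧
      ‖∑ i, (h i : ℂ) * ![(1 : ℂ), (Real.pi : ℂ) * I] i‖ < 1 / (1 + ∑ i, (|h i| : ℝ)) ^ ω := by
  push Not
  refine ⟨0, fun h hh => ?_⟩
  rw [pow_zero, div_one]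
  simp only [Fin.sum_univ_two, Matrix.cons_val_zero, Matrix.cons_val_one, mul_one]
  by_cases h0 : h 0 = 0
  · have h1 : h 1 ≠ 0 := by
      intro h1; apply hh; funext i; fin_cases i <;> simp [h0, h1]
    have habs : (1 : ℝ) ≤ |(h 1 : ℝ)| := by
      rw [← Int.cast_abs]; exact_mod_cast Int.one_le_abs h1
    rw [h0, Int.cast_zero, zero_add, norm_mul, norm_mul, Complex.norm_I, mul_one, Complex.norm_intCast,
      Complex.norm_real, Real.norm_eq_abs, abs_of_pos Real.pi_pos]
    nlinarith [Real.pi_gt_three]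
  · have habs : (1 : ℝ) ≤ |(h 0 : ℝ)| := by
      rw [← Int.cast_abs]; exact_mod_cast Int.one_le_abs h0
    calc (1 : ℝ) ≤ |(h 0 : ℝ)| := habs
      _ = |((h 0 : ℂ) + (h 1 : ℂ) * ((Real.pi : ℂ) * I)).re| := by simp
      _ ≤ ‖(h 0 : ℂ) + (h 1 : ℂ) * ((Real.pi : ℂ) * I)‖ := Complex.abs_re_le_norm _

/-- **B₃ ⟹ Schanuel's inequality at `(1, πi)`** (hence `e ⟂ π`, next theorem): the tuple `(1, πi)` is
`ℚ`-free, has no Liouville coordinate (`¬Liouville q`, `¬Liouville qπ`) and carries a polynomial measure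
(Baker at `n = 1`, `α = −1` after clearing the rational coordinate). -/
theorem two_le_trdeg_one_piI_of_polyDiophantineSchanuel (hB : PolyDiophantineSchanuel) :
    ((2 : ℕ) : Cardinal) ≤ Algebra.trdeg ℚ ↥(adjoin ℚ (Set.range ![(1 : ℂ), (Real.pi : ℂ) * I] ∪
      Set.range (cexp ∘ ![(1 : ℂ), (Real.pi : ℂ) * I]))) :=
  hB 2 _ linearIndependent_one_piI not_liouville_coord_one_piI polyMeasure_one_piI

/-- **B₃ ⟹ `e` and `π` are algebraically independent** — the tree's registered open statement
`Literature.NumberTheory.Transcendental.ExpOnePiAlgebraicIndependent` (periods.S15) from the residual ALONE.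
The transfer `trdeg ℚ(1, πi, e, −1) ≥ 2 ⟹ e ⟂ π` is the tree's argument of
`Literature.Barriers.Schanuel.expOnePiAlgebraicIndependent_of_schanuel` (NesterenkoModularScope), re-run verbatim on
the weaker input `two_le_trdeg_one_piI_of_polyDiophantineSchanuel`. -/
theorem expOnePiAlgebraicIndependent_of_polyDiophantineSchanuel (hB : PolyDiophantineSchanuel) :
    Literature.NumberTheory.Transcendental.ExpOnePiAlgebraicIndependent := by
  have h2 := two_le_trdeg_one_piI_of_polyDiophantineSchanuel hB
  set S : Set ℂ := {(Real.exp 1 : ℂ), (Real.pi : ℂ)} with hSdef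
  have he : (Real.exp 1 : ℂ) ∈ adjoin ℚ (S ∪ {I}) := subset_adjoin ℚ _ (Or.inl (by simp [hSdef]))
  have hpi : (Real.pi : ℂ) ∈ adjoin ℚ (S ∪ {I}) := subset_adjoin ℚ _ (Or.inl (by simp [hSdef]))
  have hI : I ∈ adjoin ℚ (S ∪ {I}) := subset_adjoin ℚ _ (Or.inr rfl)
  have hle : adjoin ℚ (Set.range ![(1 : ℂ), (Real.pi : ℂ) * I] ∪
      Set.range (cexp ∘ ![(1 : ℂ), (Real.pi : ℂ) * I])) ≤ adjoin ℚ (S ∪ {I}) := by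
    rw [adjoin_le_iff]
    rintro w (⟨i, rfl⟩ | ⟨i, rfl⟩) <;> fin_cases i
    · simp
    · simpa using mul_mem hpi hI
    · simp only [Fin.zero_eta, Fin.isValue, Function.comp_apply, Matrix.cons_val_zero,
        SetLike.mem_coe]
      rw [show cexp 1 = ((Real.exp 1 : ℝ) : ℂ) by rw [Complex.ofReal_exp]; simp]
      exact he
    · simp [Complex.exp_pi_mul_I]
  have h2' : ((2 : ℕ) : Cardinal) ≤ Algebra.trdeg ℚ (adjoin ℚ (S ∪ {I})) :=
    h2.trans (trdeg_le_of_injective (IntermediateField.inclusion hle)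
      (IntermediateField.inclusion_injective hle))
  have hunion := trdeg_adjoin_union_eq_of_isAlgebraic (K := ℚ) (E := ℂ) S {I}
    (fun x hx => by rw [Set.mem_singleton_iff.mp hx]; exact isAlgebraic_I)
  have h2'' : ((2 : ℕ) : Cardinal) ≤ Algebra.trdeg ℚ (adjoin ℚ S) := h2'.trans_eq hunion
  have hr : Set.range (fun i => ((![Real.exp 1, Real.pi] i : ℝ) : ℂ)) = S := by
    ext w
    simp only [Set.mem_range, hSdef, Set.mem_insert_iff, Set.mem_singleton_iff]
    constructor
    · rintro ⟨i, rfl⟩; fin_cases i <;> simp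
    · rintro (rfl | rfl)
      · exact ⟨0, by simp⟩
      · exact ⟨1, by simp⟩
  set l : Fin 2 → ℂ := fun i => ((![Real.exp 1, Real.pi] i : ℝ) : ℂ) with hldef
  have hl2 : ((2 : ℕ) : Cardinal) ≤ Algebra.trdeg ℚ (adjoin ℚ (Set.range l)) := by
    rw [hr]; exact h2''
  exact algebraicIndependent_real_of_complex _ (algebraicIndependent_of_le_trdeg_adjoin l hl2)

/-! ### §6  Placement, negative side: logarithm tuples lie outside every A-cell of the route -/

/-- `ω·log x ≤ x^{ω+1}`-type bound: for `2 ≤ S` and any `ω`, `S ^ ω ≤ exp (S ^ (ω + 1))`. -/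
private theorem pow_le_exp_pow_succ {S : ℝ} (hS : 1 ≤ S) (ω : ℕ) : S ^ ω ≤ Real.exp (S ^ (ω + 1)) := by
  have h1 : S ^ ω ≤ S ^ (ω + 1) := pow_le_pow_right₀ hS (Nat.le_succ ω)
  have h2 : S ^ (ω + 1) ≤ Real.exp (S ^ (ω + 1)) := by
    have := Real.add_one_le_exp (S ^ (ω + 1))
    linarith
  exact h1.trans h2

/-- A tuple with a polynomial measure is not hyper-Liouville (the hypothesis of item 33363). -/
theorem not_hyperLiouville_of_polyMeasure {n : ℕ} (z : Fin n → ℂ) {ω : ℕ}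
    (hω : ∀ h : Fin n → ℤ, h ≠ 0 → 1 / (1 + ∑ i, (|h i| : ℝ)) ^ ω ≤ ‖∑ i, (h i : ℂ) * z i‖) :
    ¬ ∀ m : ℕ, ∃ h : Fin n → ℤ, h ≠ 0 ∧
      ‖∑ i, (h i : ℂ) * z i‖ < Real.exp (-((1 + ∑ i, (|h i| : ℝ)) ^ m)) := by
  intro hH
  obtain ⟨h, hh, hlt⟩ := hH (ω + 1)
  have hS : (1 : ℝ) ≤ 1 + ∑ i, (|h i| : ℝ) := by
    have : (0 : ℝ) ≤ ∑ i, (|h i| : ℝ) := sum_nonneg fun i _ => abs_nonneg _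
    linarith
  have hSpos : (0 : ℝ) < 1 + ∑ i, (|h i| : ℝ) := by linarith
  have h1 := hω h hh
  have h2 : Real.exp (-((1 + ∑ i, (|h i| : ℝ)) ^ (ω + 1))) ≤ 1 / (1 + ∑ i, (|h i| : ℝ)) ^ ω := by
    rw [Real.exp_neg, one_div]
    exact inv_anti₀ (pow_pos hSpos _) (pow_le_exp_pow_succ hS ω)
  linarith

/-- **Placement of record.** A `ℚ`-free tuple of logarithms of algebraic numbers satisfies NONE of the
scope hypotheses of the route's A-cells — not `CoordLiouvilleSchanuel`'s (31077: a Liouville coordinate),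
not `HyperLiouvilleSchanuel`'s (33363), not `FiniteOrderLiouvilleSchanuel`'s / `LinLiouvilleSchanuel`'s
(33364 / 31986: linearly Liouville) — and BOTH hypotheses of the residual `PolyDiophantineSchanuel`. -/
theorem logs_placement {n : ℕ} (l : Fin n → ℂ) (halg : ∀ i, IsAlgebraic ℚ (cexp (l i)))
    (hli : LinearIndependent ℚ l) :
    (¬ ∃ w ∈ Submodule.span ℚ (Set.range l), Liouville w.re ∨ Liouville w.im) ∧
    (¬ ∀ m : ℕ, ∃ h : Fin n → ℤ, h ≠ 0 ∧
        ‖∑ i, (h i : ℂ) * l i‖ < Real.exp (-((1 + ∑ i, (|h i| : ℝ)) ^ m))) ∧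
    (¬ ∀ ω : ℕ, ∃ h : Fin n → ℤ, h ≠ 0 ∧ ‖∑ i, (h i : ℂ) * l i‖ < 1 / (1 + ∑ i, (|h i| : ℝ)) ^ ω) := by
  obtain ⟨ω, hω⟩ := polyMeasure_of_logs l halg hli
  refine ⟨not_liouville_coord_of_logs l halg, not_hyperLiouville_of_polyMeasure l hω, ?_⟩
  push Not
  exact ⟨ω, fun h hh => hω h hh⟩

/-- The four A-cells are each VACUOUSLY true on logarithm tuples (their scope hypotheses fail there),
so on barrier B1's tuples the route's `closes` draws everything from the residual. Recorded as: the
cells' hypotheses at a log tuple are each refutable. -/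
theorem cells_vacuous_at_logs {n : ℕ} (l : Fin n → ℂ) (halg : ∀ i, IsAlgebraic ℚ (cexp (l i)))
    (hli : LinearIndependent ℚ l) :
    ((∃ w ∈ Submodule.span ℚ (Set.range l), Liouville w.re ∨ Liouville w.im) → False) ∧
    ((∀ m : ℕ, ∃ h : Fin n → ℤ, h ≠ 0 ∧
        ‖∑ i, (h i : ℂ) * l i‖ < Real.exp (-((1 + ∑ i, (|h i| : ℝ)) ^ m))) → False) ∧
    ((∀ ω : ℕ, ∃ h : Fin n → ℤ, h ≠ 0 ∧
        ‖∑ i, (h i : ℂ) * l i‖ < 1 / (1 + ∑ i, (|h i| : ℝ)) ^ ω) → False) :=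
  logs_placement l halg hli

/-! ### §7  The strict cell: `StrictDiophantineSchanuel` (31078, aside) also contains the barrier -/

/-- The retired/aside item `StrictDiophantineSchanuel` (no Liouville coordinate ⟹ Schanuel) likewise
implies `AlgIndepLogarithms`. -/
theorem algIndepLogarithms_of_strictDiophantineSchanuel (hS : StrictDiophantineSchanuel) :
    AlgIndepLogarithms := by
  intro n l halg hli
  have hT : ∀ x ∈ Set.range (cexp ∘ l), IsAlgebraic ℚ x := by
    rintro _ ⟨i, rfl⟩; exact halg i
  exact algebraicIndependent_of_le_trdeg_adjoin l
    ((hS n l hli (not_liouville_coord_of_logs l halg)).trans_eq (trdeg_adjoin_union_eq_of_isAlgebraic _ _ hT))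

end Summit.Schanuel.Schanuel.Theorems.RootDecomp1KB3LogBarrier

end
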